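import Summits.Ventures.PercRepro.Night2NearFatCount
import Summits.Ventures.PercRepro.Night2NearFatShape
import Summits.Ventures.PercRepro.Night2HighFrom

/-!
# night-2: THE NON-SUSPECT FAMILY OF THE NON-THREE-PLANAR CASE (gen 40)

For a lossy basis pair whose `V` is not three-planar, the targets `Q ∪ Y` with `Y` NON-SUSPECT (`≤ |Y| − 2` points on every
basis line, inside no line through a basis point) are unloaded (Night2NearFatShape), so the top ones (`|W| ≤ |Y| + 3`) have
`vCap = 1` and the hitting ones `vCap ≥ 11/18` (gen 39's `free_term`).  Their number per level is at least
`C(N, i) − [non-top] 5 C(N−2, i) − (h(ℓ₁) + h(ℓ₂) + C(|C₁|, i) + C(|C₂|, i))` (Night2NearFatCount) when every basis line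
lies inside `ℓ₁` or `ℓ₂` or has `≤ s − 2` points and every line through a basis point lies inside `C₁` or `C₂` or has
`≤ s − 1` points.  **`basis_pair_fair_of_ntp`**: `1 ≤ ntpIncome N s |ℓ₁| |ℓ₂| |C₁| |C₂|` ⇒ the pair is fair.
Paper: proofs/NIGHT-2-g40.md §3.
-/

namespace PercRepro.Shadow

open PercRepro.ThmH PercRepro.PerFlat

variable {α : Type*} [DecidableEq α] {M : Matroid α} [M.Finite] {G : Finset α}

/-- The suspect bound at level `i`: `h(d₁) + h(d₂) + C(e₁, i) + C(e₂, i)`, `h(d) = C(d, i−1) (N − d) + C(d, i)`. -/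
def suspBound (N i d₁ d₂ e₁ e₂ : ℕ) : ℕ :=
  (d₁.choose (i - 1) * (N - d₁) + d₁.choose i) + (d₂.choose (i - 1) * (N - d₂) + d₂.choose i) +
    (e₁.choose i + e₂.choose i)

/-- The non-three-planar income from the start level `s`. -/
noncomputable def ntpIncome (N s d₁ d₂ e₁ e₂ : ℕ) : ℚ :=
  ∑ i ∈ Finset.range (N + 1), if s ≤ i then
    (if N ≤ i + 3 then (1 : ℚ) else 11 / 18) *
      max 0 (((N.choose i : ℕ) : ℚ) - (if N ≤ i + 3 then (0 : ℚ) else 5 * (((N - 2).choose i : ℕ) : ℚ)) -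
        ((suspBound N i d₁ d₂ e₁ e₂ : ℕ) : ℚ)) * 3 / (((i + 5).choose 4 : ℕ) : ℚ)
  else 0

omit [DecidableEq α] in
/-- **The abstract regrouping from the start level `s`.** -/
theorem ntpIncome_le_sum_filter (W : Finset α) (P : Finset α → Prop) [DecidablePred P] (s d₁ d₂ e₁ e₂ : ℕ)
    (hcount : ∀ i, s ≤ i →
      ((W.card.choose i : ℕ) : ℚ) - (if W.card ≤ i + 3 then (0 : ℚ) else 5 * (((W.card - 2).choose i : ℕ) : ℚ)) -
        ((suspBound W.card i d₁ d₂ e₁ e₂ : ℕ) : ℚ) ≤ (((W.powersetCard i).filter P).card : ℚ)) :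
    ntpIncome W.card s d₁ d₂ e₁ e₂ ≤
      ∑ Y ∈ W.powerset.filter (fun Y => s ≤ Y.card ∧ P Y),
        (if W.card ≤ Y.card + 3 then (1 : ℚ) else 11 / 18) * 3 / (((Y.card + 5).choose 4 : ℕ) : ℚ) := by
  set fam : Finset (Finset α) := W.powerset.filter (fun Y => s ≤ Y.card ∧ P Y) with hfam
  have hmaps : ∀ Y ∈ fam, Y.card ∈ Finset.range (W.card + 1) := fun Y hY =>
    Finset.mem_range.2 (Nat.lt_succ_of_le (Finset.card_le_card
      (Finset.mem_powerset.1 (Finset.mem_filter.1 hY).1)))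
  have hfiber := Finset.sum_fiberwise_of_maps_to hmaps
    (fun Y => (if W.card ≤ Y.card + 3 then (1 : ℚ) else 11 / 18) * 3 / (((Y.card + 5).choose 4 : ℕ) : ℚ))
  rw [← hfiber]
  unfold ntpIncome
  apply Finset.sum_le_sum
  intro i _
  have hfib : ∑ Y ∈ fam.filter (fun Y => Y.card = i),
      (if W.card ≤ Y.card + 3 then (1 : ℚ) else 11 / 18) * 3 / (((Y.card + 5).choose 4 : ℕ) : ℚ) =
      ((fam.filter (fun Y => Y.card = i)).card : ℚ) *
        ((if W.card ≤ i + 3 then (1 : ℚ) else 11 / 18) * 3 / (((i + 5).choose 4 : ℕ) : ℚ)) := by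
    rw [Finset.sum_congr rfl (fun Y hY => by rw [(Finset.mem_filter.1 hY).2])]
    rw [Finset.sum_const, nsmul_eq_mul]
  rw [hfib]
  by_cases hsi : s ≤ i
  · rw [if_pos hsi]
    have hsub : (W.powersetCard i).filter P ⊆ fam.filter (fun Y => Y.card = i) := by
      intro Y hY
      rw [Finset.mem_filter, Finset.mem_powersetCard] at hY
      obtain ⟨⟨hYW, hYi⟩, hP⟩ := hY
      rw [Finset.mem_filter, hfam, Finset.mem_filter, Finset.mem_powerset]
      exact ⟨⟨hYW, by omega, hP⟩, hYi⟩
    have hcard : (((W.powersetCard i).filter P).card : ℚ) ≤ ((fam.filter (fun Y => Y.card = i)).card : ℚ) := by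
      exact_mod_cast Finset.card_le_card hsub
    set w : ℚ := (if W.card ≤ i + 3 then (1 : ℚ) else 11 / 18) with hw
    set c : ℚ := (if W.card ≤ i + 3 then (0 : ℚ) else 5 * (((W.card - 2).choose i : ℕ) : ℚ)) with hc
    have hw0 : 0 ≤ w := by
      rw [hw]
      split_ifs <;> norm_num
    have hC : (0 : ℚ) ≤ w * 3 / (((i + 5).choose 4 : ℕ) : ℚ) := by positivity
    have hmax : max 0 (((W.card.choose i : ℕ) : ℚ) - c - ((suspBound W.card i d₁ d₂ e₁ e₂ : ℕ) : ℚ)) ≤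
        ((fam.filter (fun Y => Y.card = i)).card : ℚ) :=
      max_le (by positivity) (le_trans (hcount i hsi) hcard)
    calc w * max 0 (((W.card.choose i : ℕ) : ℚ) - c - ((suspBound W.card i d₁ d₂ e₁ e₂ : ℕ) : ℚ)) * 3 /
          (((i + 5).choose 4 : ℕ) : ℚ)
        = max 0 (((W.card.choose i : ℕ) : ℚ) - c - ((suspBound W.card i d₁ d₂ e₁ e₂ : ℕ) : ℚ)) *
            (w * 3 / (((i + 5).choose 4 : ℕ) : ℚ)) := by ring
      _ ≤ ((fam.filter (fun Y => Y.card = i)).card : ℚ) * (w * 3 / (((i + 5).choose 4 : ℕ) : ℚ)) :=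
          mul_le_mul_of_nonneg_right hmax hC
  · rw [if_neg hsi]
    have hw0 : (0 : ℚ) ≤ (if W.card ≤ i + 3 then (1 : ℚ) else 11 / 18) := by
      split_ifs <;> norm_num
    positivity

/-- **The suspect count of a basis pair**: with every basis line inside `ℓ₁` or `ℓ₂` or of `≤ s − 2` points and every line
through a basis point inside `C₁` or `C₂` or of `≤ s − 1` points, the suspect `i`-subsets (`i ≥ s`) of `W` number at most
`suspBound N i |ℓ₁| |ℓ₂| |C₁| |C₂|`. -/
theorem card_filter_suspect_basis_le {B : Finset α} {z : α} {ℓ₁ ℓ₂ C₁ C₂ : Finset α} {s : ℕ} (hs1 : 1 ≤ s)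
    (hℓ₁ : ℓ₁ ⊆ G \ insert z B) (hℓ₂ : ℓ₂ ⊆ G \ insert z B)
    (hB2 : ∀ a ∈ insert z B \ coloops M G, ∀ b ∈ insert z B \ coloops M G, a ≠ b →
      (G \ insert z B) ∩ clF M {a, b} ⊆ ℓ₁ ∨ (G \ insert z B) ∩ clF M {a, b} ⊆ ℓ₂ ∨
        ((G \ insert z B) ∩ clF M {a, b}).card + 2 ≤ s)
    (hB1 : ∀ a ∈ insert z B \ coloops M G, ∀ y ∈ G \ insert z B,
      (G \ insert z B) ∩ clF M {a, y} ⊆ C₁ ∨ (G \ insert z B) ∩ clF M {a, y} ⊆ C₂ ∨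
        ((G \ insert z B) ∩ clF M {a, y}).card + 1 ≤ s)
    {i : ℕ} (hsi : s ≤ i) :
    (((G \ insert z B).powersetCard i).filter (fun Y =>
      (∃ a ∈ insert z B \ coloops M G, ∃ b ∈ insert z B \ coloops M G, a ≠ b ∧
        Y.card ≤ (Y ∩ clF M {a, b}).card + 1) ∨
      ∃ a ∈ insert z B \ coloops M G, ∃ y ∈ Y, Y ⊆ clF M {a, y})).card ≤
      suspBound (G \ insert z B).card i ℓ₁.card ℓ₂.card C₁.card C₂.card := by
  set W := G \ insert z B with hW
  set 𝓑 : Finset (Finset α) := (((insert z B \ coloops M G) ×ˢ (insert z B \ coloops M G)).filter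
    (fun p => p.1 ≠ p.2)).image (fun p => W ∩ clF M {p.1, p.2}) with h𝓑
  set 𝓒 : Finset (Finset α) := ((insert z B \ coloops M G) ×ˢ W).image (fun p => W ∩ clF M {p.1, p.2}) with h𝓒
  have hsub : (W.powersetCard i).filter (fun Y =>
      (∃ a ∈ insert z B \ coloops M G, ∃ b ∈ insert z B \ coloops M G, a ≠ b ∧
        Y.card ≤ (Y ∩ clF M {a, b}).card + 1) ∨
      ∃ a ∈ insert z B \ coloops M G, ∃ y ∈ Y, Y ⊆ clF M {a, y}) ⊆
      (W.powersetCard i).filter (fun Y => (∃ ℓ ∈ 𝓑, i - 1 ≤ (Y ∩ ℓ).card) ∨ ∃ C ∈ 𝓒, Y ⊆ C) := by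
    intro Y hY
    rw [Finset.mem_filter] at hY ⊢
    obtain ⟨hYW, hcase⟩ := hY
    have hYW' : Y ⊆ W := (Finset.mem_powersetCard.1 hYW).1
    have hYi : Y.card = i := (Finset.mem_powersetCard.1 hYW).2
    refine ⟨hYW, ?_⟩
    rcases hcase with ⟨a, ha, b, hb, hab, hYab⟩ | ⟨a, ha, y, hy, hYay⟩
    · left
      refine ⟨W ∩ clF M {a, b}, ?_, ?_⟩
      · rw [h𝓑, Finset.mem_image]
        exact ⟨(a, b), Finset.mem_filter.2 ⟨Finset.mem_product.2 ⟨ha, hb⟩, hab⟩, rfl⟩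
      · have heq : Y ∩ (W ∩ clF M {a, b}) = Y ∩ clF M {a, b} := by
          ext v
          simp only [Finset.mem_inter]
          exact ⟨fun h => ⟨h.1, h.2.2⟩, fun h => ⟨h.1, hYW' h.1, h.2⟩⟩
        rw [heq]
        omega
    · right
      refine ⟨W ∩ clF M {a, y}, ?_, ?_⟩
      · rw [h𝓒, Finset.mem_image]
        exact ⟨(a, y), Finset.mem_product.2 ⟨ha, hYW' hy⟩, rfl⟩
      · exact Finset.subset_inter hYW' hYay
  refine le_trans (Finset.card_le_card hsub) ?_
  have h𝓑' : ∀ ℓ ∈ 𝓑, ℓ ⊆ ℓ₁ ∨ ℓ ⊆ ℓ₂ ∨ ℓ.card + 2 ≤ i := by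
    intro ℓ hℓ
    rw [h𝓑, Finset.mem_image] at hℓ
    obtain ⟨p, hp, rfl⟩ := hℓ
    rw [Finset.mem_filter, Finset.mem_product] at hp
    rcases hB2 p.1 hp.1.1 p.2 hp.1.2 hp.2 with h | h | h
    · exact Or.inl h
    · exact Or.inr (Or.inl h)
    · exact Or.inr (Or.inr (by omega))
  have h𝓒' : ∀ C ∈ 𝓒, C ⊆ C₁ ∨ C ⊆ C₂ ∨ C.card + 1 ≤ i := by
    intro C hC
    rw [h𝓒, Finset.mem_image] at hC
    obtain ⟨p, hp, rfl⟩ := hC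
    rw [Finset.mem_product] at hp
    rcases hB1 p.1 hp.1 p.2 hp.2 with h | h | h
    · exact Or.inl h
    · exact Or.inr (Or.inl h)
    · exact Or.inr (Or.inr (by omega))
  have h := card_filter_suspect_le W ℓ₁ ℓ₂ C₁ C₂ 𝓑 𝓒 i (by omega) h𝓑' h𝓒'
  rw [Finset.card_sdiff_of_subset hℓ₁, Finset.card_sdiff_of_subset hℓ₂] at h
  exact h

/-- **The non-suspect top-or-hitting targets from the start level `s`** are targets of income at least
`ntpIncome N s |ℓ₁| |ℓ₂| |C₁| |C₂|` (every one of them unloaded by the shape lemma of the non-three-planar case). -/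
theorem ntp_targets_subset_and_income (hG : G ∈ flatsQ M (5 + 1)) (hd : (gr M \ G).card = 2)
    (hk : kColoops M G = 1) (hnf : fatClosures M 5 G 2 = ∅)
    {B : Finset α} (hB : B ∈ thinMembers M 5 G) (hnP : ¬ bigP M G B) {z : α} (hz : z ∈ G \ clF M B)
    (hl0 : loss M 5 G B z ≠ 0) {ℓ₁ ℓ₂ C₁ C₂ : Finset α} {s : ℕ} (hs1 : 1 ≤ s)
    (hdl : ∀ Y ⊆ G \ insert z B, s ≤ Y.card →
      ¬ ((∃ a ∈ insert z B \ coloops M G, ∃ b ∈ insert z B \ coloops M G, a ≠ b ∧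
          Y.card ≤ (Y ∩ clF M {a, b}).card + 1) ∨
        ∃ a ∈ insert z B \ coloops M G, ∃ y ∈ Y, Y ⊆ clF M {a, y}) →
      dload M 5 G (bigP M G) (dshGT2 M 5 G) (insert z B ∪ Y) = 0)
    (hℓ₁ : ℓ₁ ⊆ G \ insert z B) (hℓ₂ : ℓ₂ ⊆ G \ insert z B)
    (hB2 : ∀ a ∈ insert z B \ coloops M G, ∀ b ∈ insert z B \ coloops M G, a ≠ b →
      (G \ insert z B) ∩ clF M {a, b} ⊆ ℓ₁ ∨ (G \ insert z B) ∩ clF M {a, b} ⊆ ℓ₂ ∨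
        ((G \ insert z B) ∩ clF M {a, b}).card + 2 ≤ s)
    (hB1 : ∀ a ∈ insert z B \ coloops M G, ∀ y ∈ G \ insert z B,
      (G \ insert z B) ∩ clF M {a, y} ⊆ C₁ ∨ (G \ insert z B) ∩ clF M {a, y} ⊆ C₂ ∨
        ((G \ insert z B) ∩ clF M {a, y}).card + 1 ≤ s) :
    (((G \ insert z B).powerset.filter (fun Y => s ≤ Y.card ∧
        (¬ ((∃ a ∈ insert z B \ coloops M G, ∃ b ∈ insert z B \ coloops M G, a ≠ b ∧
            Y.card ≤ (Y ∩ clF M {a, b}).card + 1) ∨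
          ∃ a ∈ insert z B \ coloops M G, ∃ y ∈ Y, Y ⊆ clF M {a, y}) ∧
        ((G \ insert z B).card ≤ Y.card + 3 ∨
          ∀ w ∈ (insert z B \ coloops M G).filter (fun w => faceOk M G (insert z B) w),
            ¬ Y ⊆ clF M ((insert z B).erase w))))).image (fun Y => insert z B ∪ Y)) ⊆ tgtSets M 5 G B z ∧
      ntpIncome (G \ insert z B).card s ℓ₁.card ℓ₂.card C₁.card C₂.card ≤
        ∑ T ∈ ((G \ insert z B).powerset.filter (fun Y => s ≤ Y.card ∧
          (¬ ((∃ a ∈ insert z B \ coloops M G, ∃ b ∈ insert z B \ coloops M G, a ≠ b ∧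
              Y.card ≤ (Y ∩ clF M {a, b}).card + 1) ∨
            ∃ a ∈ insert z B \ coloops M G, ∃ y ∈ Y, Y ⊆ clF M {a, y}) ∧
          ((G \ insert z B).card ≤ Y.card + 3 ∨
            ∀ w ∈ (insert z B \ coloops M G).filter (fun w => faceOk M G (insert z B) w),
              ¬ Y ⊆ clF M ((insert z B).erase w))))).image (fun Y => insert z B ∪ Y),
          vCap M G T / faceSum M G T := by
  set W := G \ insert z B with hW
  set Susp : Finset α → Prop := fun Y =>
    (∃ a ∈ insert z B \ coloops M G, ∃ b ∈ insert z B \ coloops M G, a ≠ b ∧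
      Y.card ≤ (Y ∩ clF M {a, b}).card + 1) ∨
    ∃ a ∈ insert z B \ coloops M G, ∃ y ∈ Y, Y ⊆ clF M {a, y} with hSusp
  set Hit : Finset α → Prop := fun Y =>
    ∀ w ∈ (insert z B \ coloops M G).filter (fun w => faceOk M G (insert z B) w),
      ¬ Y ⊆ clF M ((insert z B).erase w) with hHit
  set P : Finset α → Prop := fun Y => ¬ Susp Y ∧ (W.card ≤ Y.card + 3 ∨ Hit Y) with hP
  set fam : Finset (Finset α) := W.powerset.filter (fun Y => s ≤ Y.card ∧ P Y) with hfam
  set 𝒯 : Finset (Finset α) := fam.image (fun Y => insert z B ∪ Y) with h𝒯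
  have hmem : ∀ Y ∈ fam, Y ⊆ W ∧ s ≤ Y.card ∧ P Y := by
    intro Y hY
    rw [hfam, Finset.mem_filter, Finset.mem_powerset] at hY
    exact ⟨hY.1, hY.2.1, hY.2.2⟩
  have h𝒯sub : 𝒯 ⊆ tgtSets M 5 G B z := by
    intro T hT
    rw [h𝒯, Finset.mem_image] at hT
    obtain ⟨Y, hY, rfl⟩ := hT
    obtain ⟨hYW, hYc, -⟩ := hmem Y hY
    rw [tgtSets_eq_image hG (mem_thinMembers.1 hB).1 hz, Finset.mem_image]
    refine ⟨Y, Finset.mem_filter.2 ⟨Finset.mem_powerset.2 hYW, ?_⟩, rfl⟩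
    rw [← Finset.card_pos]
    omega
  have hinj : Set.InjOn (fun Y => insert z B ∪ Y) (fam : Set (Finset α)) := by
    intro Y₁ hY₁ Y₂ hY₂ heq
    rw [Finset.mem_coe] at hY₁ hY₂
    have key : ∀ Y ∈ fam, (insert z B ∪ Y) ∩ W = Y := by
      intro Y hY
      ext x
      rw [Finset.mem_inter, Finset.mem_union]
      constructor
      · rintro ⟨hx | hx, hxW⟩
        · exact absurd hx (Finset.mem_sdiff.1 hxW).2
        · exact hx
      · intro hx
        exact ⟨Or.inr hx, (hmem Y hY).1 hx⟩
    have h1 := key Y₁ hY₁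
    have h2 := key Y₂ hY₂
    simp only at heq
    rw [← h1, ← h2, heq]
  have hterm : ∀ Y ∈ fam, (if W.card ≤ Y.card + 3 then (1 : ℚ) else 11 / 18) * 3 /
      (((Y.card + 5).choose 4 : ℕ) : ℚ) ≤ vCap M G (insert z B ∪ Y) / faceSum M G (insert z B ∪ Y) := by
    intro Y hY
    obtain ⟨hYW, hYc, hnS, hYtop⟩ := hmem Y hY
    have hne : Y.Nonempty := by
      rw [← Finset.card_pos]
      omega
    exact free_term hG hd hk hnf hB hnP hz hl0 hYW hne (hdl Y hYW hYc hnS) hYtop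
  have hsum𝒯 : ∑ Y ∈ fam, (if W.card ≤ Y.card + 3 then (1 : ℚ) else 11 / 18) * 3 /
      (((Y.card + 5).choose 4 : ℕ) : ℚ) ≤ ∑ T ∈ 𝒯, vCap M G T / faceSum M G T := by
    rw [h𝒯, Finset.sum_image hinj]
    exact Finset.sum_le_sum hterm
  refine ⟨h𝒯sub, le_trans ?_ hsum𝒯⟩
  apply ntpIncome_le_sum_filter W P s
  intro i hsi
  have hSusp := card_filter_suspect_basis_le hs1 hℓ₁ hℓ₂ hB2 hB1 hsi
  have hSusp' : (((W.powersetCard i).filter Susp).card : ℚ) ≤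
      ((suspBound W.card i ℓ₁.card ℓ₂.card C₁.card C₂.card : ℕ) : ℚ) := by exact_mod_cast hSusp
  by_cases htop : W.card ≤ i + 3
  · rw [if_pos htop]
    have hsplit := Finset.card_filter_add_card_filter_not (s := W.powersetCard i) Susp
    rw [Finset.card_powersetCard] at hsplit
    have hsub : (W.powersetCard i).filter (fun Y => ¬ Susp Y) ⊆ (W.powersetCard i).filter P := by
      intro Y hY
      rw [Finset.mem_filter] at hY ⊢
      have hYi : Y.card = i := (Finset.mem_powersetCard.1 hY.1).2
      exact ⟨hY.1, hY.2, Or.inl (by omega)⟩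
    have h1 : (((W.powersetCard i).filter (fun Y => ¬ Susp Y)).card : ℚ) ≤
        (((W.powersetCard i).filter P).card : ℚ) := by exact_mod_cast Finset.card_le_card hsub
    have h2 : (((W.powersetCard i).filter Susp).card : ℚ) +
        (((W.powersetCard i).filter (fun Y => ¬ Susp Y)).card : ℚ) = ((W.card.choose i : ℕ) : ℚ) := by
      exact_mod_cast hsplit
    linarith
  · rw [if_neg htop]
    have hQG : insert z B ⊆ G :=
      Finset.insert_subset (Finset.mem_sdiff.1 hz).1 (subset_G_of_mem_thinMembers hB)
    have hC : ∀ w ∈ (insert z B \ coloops M G).filter (fun w => faceOk M G (insert z B) w),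
        (clF M ((insert z B).erase w) ∩ W).card + 2 ≤ W.card := by
      intro w hw
      have hok := (Finset.mem_filter.1 hw).2
      have h2 : 2 ≤ (W \ clF M ((insert z B).erase w)).card := two_le_card_holes hG hnf hQG hok
      have hsplit := Finset.card_sdiff_add_card_inter W (clF M ((insert z B).erase w))
      rw [Finset.inter_comm]
      omega
    have hA : ((insert z B \ coloops M G).filter (fun w => faceOk M G (insert z B) w)).card ≤ 5 := by
      obtain ⟨-, hQ'5⟩ := rkN_insert_sdiff_coloops_eq_five hG hd hk hB hnP hz
      rw [← hQ'5]
      exact Finset.card_filter_le _ _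
    have hA' : (((insert z B \ coloops M G).filter (fun w => faceOk M G (insert z B) w)).card : ℚ) ≤ 5 := by
      exact_mod_cast hA
    have h := card_filter_good_ge W ((insert z B \ coloops M G).filter (fun w => faceOk M G (insert z B) w))
      (fun w => clF M ((insert z B).erase w)) hC Susp i
    have hsub : (W.powersetCard i).filter (fun Y => ¬ Susp Y ∧
        ∀ w ∈ (insert z B \ coloops M G).filter (fun w => faceOk M G (insert z B) w),
          ¬ Y ⊆ clF M ((insert z B).erase w)) ⊆ (W.powersetCard i).filter P := by
      intro Y hY
      rw [Finset.mem_filter] at hY ⊢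
      exact ⟨hY.1, hY.2.1, Or.inr hY.2.2⟩
    have h1 : ((((W.powersetCard i).filter (fun Y => ¬ Susp Y ∧
        ∀ w ∈ (insert z B \ coloops M G).filter (fun w => faceOk M G (insert z B) w),
          ¬ Y ⊆ clF M ((insert z B).erase w))).card : ℕ) : ℚ) ≤
        (((W.powersetCard i).filter P).card : ℚ) := by exact_mod_cast Finset.card_le_card hsub
    have h0 : (0 : ℚ) ≤ (((W.card - 2).choose i : ℕ) : ℚ) := by positivity
    nlinarith

/-- **THE NON-SUSPECT FAMILY THEOREM**: `1 ≤ ntpIncome N s |ℓ₁| |ℓ₂| |C₁| |C₂|` ⇒ the basis pair is fair. -/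
theorem basis_pair_fair_of_ntp (hG : G ∈ flatsQ M (5 + 1)) (hd : (gr M \ G).card = 2)
    (hk : kColoops M G = 1) (hs : ∀ e ∈ gr M, ∀ f ∈ gr M, e ≠ f → rkN M {e, f} = 2)
    (hl : ∀ e ∈ gr M, M.Indep {e}) (hnf : fatClosures M 5 G 2 = ∅)
    {B : Finset α} (hB : B ∈ thinMembers M 5 G) (hnP : ¬ bigP M G B) {z : α} (hz : z ∈ G \ clF M B)
    (hl0 : loss M 5 G B z ≠ 0) {ℓ₁ ℓ₂ C₁ C₂ : Finset α} {s : ℕ} (hs1 : 1 ≤ s)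
    (hdl : ∀ Y ⊆ G \ insert z B, s ≤ Y.card →
      ¬ ((∃ a ∈ insert z B \ coloops M G, ∃ b ∈ insert z B \ coloops M G, a ≠ b ∧
          Y.card ≤ (Y ∩ clF M {a, b}).card + 1) ∨
        ∃ a ∈ insert z B \ coloops M G, ∃ y ∈ Y, Y ⊆ clF M {a, y}) →
      dload M 5 G (bigP M G) (dshGT2 M 5 G) (insert z B ∪ Y) = 0)
    (hℓ₁ : ℓ₁ ⊆ G \ insert z B) (hℓ₂ : ℓ₂ ⊆ G \ insert z B)
    (hB2 : ∀ a ∈ insert z B \ coloops M G, ∀ b ∈ insert z B \ coloops M G, a ≠ b →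
      (G \ insert z B) ∩ clF M {a, b} ⊆ ℓ₁ ∨ (G \ insert z B) ∩ clF M {a, b} ⊆ ℓ₂ ∨
        ((G \ insert z B) ∩ clF M {a, b}).card + 2 ≤ s)
    (hB1 : ∀ a ∈ insert z B \ coloops M G, ∀ y ∈ G \ insert z B,
      (G \ insert z B) ∩ clF M {a, y} ⊆ C₁ ∨ (G \ insert z B) ∩ clF M {a, y} ⊆ C₂ ∨
        ((G \ insert z B) ∩ clF M {a, y}).card + 1 ≤ s)
    (hsum : 1 ≤ ntpIncome (G \ insert z B).card s ℓ₁.card ℓ₂.card C₁.card C₂.card) :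
    loss M 5 G B z ≤ rhoL M 5 G B z * lossIncomeH M 5 G (bigP M G) (dshGT2 M 5 G) B z := by
  have hfat : (fatClosures M 5 G 2).card ≤ 1 := by
    rw [hnf, Finset.card_empty]
    exact zero_le_one
  obtain ⟨hsub, hinc⟩ := ntp_targets_subset_and_income hG hd hk hnf hB hnP hz hl0 hs1 hdl hℓ₁ hℓ₂ hB2 hB1
  exact basis_pair_fair_of_vCap_face_sum_subfamily hG hd hk hs hl hfat hB hnP hz hl0 hsub (hsum.trans hinc)

/-- **THE NON-SUSPECT FAMILY THEOREM, non-three-planar form**: with `V` not three-planar the shape lemma unloads every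
non-suspect target. -/
theorem basis_pair_fair_of_ntp_of_not_threePlanar (hG : G ∈ flatsQ M (5 + 1)) (hd : (gr M \ G).card = 2)
    (hk : kColoops M G = 1) (hs : ∀ e ∈ gr M, ∀ f ∈ gr M, e ≠ f → rkN M {e, f} = 2)
    (hl : ∀ e ∈ gr M, M.Indep {e}) (hnf : fatClosures M 5 G 2 = ∅)
    (hntp : ¬ (∃ R ⊆ G \ coloops M G, rkN M R = 2 ∧ ∃ c ∈ G \ coloops M G, ∃ d ∈ G \ coloops M G,
      ∃ e ∈ G \ coloops M G, G \ coloops M G ⊆ clF M (insert c R) ∪ clF M (insert d R) ∪ clF M (insert e R)))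
    {B : Finset α} (hB : B ∈ thinMembers M 5 G) (hnP : ¬ bigP M G B) {z : α} (hz : z ∈ G \ clF M B)
    (hl0 : loss M 5 G B z ≠ 0) {ℓ₁ ℓ₂ C₁ C₂ : Finset α} {s : ℕ} (hs1 : 1 ≤ s)
    (hℓ₁ : ℓ₁ ⊆ G \ insert z B) (hℓ₂ : ℓ₂ ⊆ G \ insert z B)
    (hB2 : ∀ a ∈ insert z B \ coloops M G, ∀ b ∈ insert z B \ coloops M G, a ≠ b →
      (G \ insert z B) ∩ clF M {a, b} ⊆ ℓ₁ ∨ (G \ insert z B) ∩ clF M {a, b} ⊆ ℓ₂ ∨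
        ((G \ insert z B) ∩ clF M {a, b}).card + 2 ≤ s)
    (hB1 : ∀ a ∈ insert z B \ coloops M G, ∀ y ∈ G \ insert z B,
      (G \ insert z B) ∩ clF M {a, y} ⊆ C₁ ∨ (G \ insert z B) ∩ clF M {a, y} ⊆ C₂ ∨
        ((G \ insert z B) ∩ clF M {a, y}).card + 1 ≤ s)
    (hsum : 1 ≤ ntpIncome (G \ insert z B).card s ℓ₁.card ℓ₂.card C₁.card C₂.card) :
    loss M 5 G B z ≤ rhoL M 5 G B z * lossIncomeH M 5 G (bigP M G) (dshGT2 M 5 G) B z := by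
  have hfat : (fatClosures M 5 G 2).card ≤ 1 := by
    rw [hnf, Finset.card_empty]
    exact zero_le_one
  apply basis_pair_fair_of_ntp hG hd hk hs hl hnf hB hnP hz hl0 hs1 _ hℓ₁ hℓ₂ hB2 hB1 hsum
  intro Y hYW _ hnS
  apply dload_eq_zero_of_not_threePlanar_of_shape hG hd hk hs hl hfat hntp hB hnP hz hYW
  · intro a ha b hb hab
    by_contra hlt
    exact hnS (Or.inl ⟨a, ha, b, hb, hab, by omega⟩)
  · intro a ha y hy hsub
    exact hnS (Or.inr ⟨a, ha, y, hy, hsub⟩)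

end PercRepro.Shadow
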